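import Summits.NavierStokesRegularity.NavierStokesRegularity.Theorems.FilamentSkeletonRssKelvinGateDefs
import Summits.NavierStokesRegularity.NavierStokesRegularity.Theorems.FilamentSkeletonRssKelvinGateRotation

/-!
# Route `FilamentSkeletonRss` · crux `TransverseReductionRJ` (stmt-NavierStokesRegularity-21221) — line `kelvin_gate`,
# stub S2′ `EventualKelvinGate`: RATE LOCKING — the rotation-cokernel pairings at a zero of the multiplier map are
# slaved to the `p`-gradient of the rate `α_p`

Helper file (theorems only, `--supports stmt-NavierStokesRegularity-21221 --as helper`), in the vocabulary of
`FilamentSkeletonRssKelvinGateDefs` (`Theorems.KelvinGate.*`).  HONEST FRAMING: bookkeeping for a HYPOTHETICAL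
filament-type RSS blow-up route (refutation side); nothing here bears on Navier–Stokes regularity, and nothing here
proves or refutes the stub.  This is the "η_rot test harness against an abstract reduced family" asked for by
director-ns dss_53 (i), and it sharpens the kill-first quantity (O1) of the obstruction ledger (evidence #25 on the
item) into an IDENTITY.

## What is proved (items 4–5 also in "core" form on exactly the clause-(1) data `GateSpec.perturb_core` delivers)

1. `hasDerivAt_lerayOp_family` — along a one-parameter family, if `t ↦ α_t`, `U_t(y)`, `DU_t(y)`, `ΔU_t(y)` are
   differentiable at `0` with derivatives `a`, `V(y)`, `DV(y)`, `ΔV(y)`, then `t ↦ E_(α_t)(U_t)(y)` has derivative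
   `𝓛_(α₀,U₀) V (y) + a · 𝓡₀U₀(y)`, `𝓡₀U = e₃ × U − DU[e₃ × y]` the rotation direction of `…KelvinGateRotation`.
2. `lerayLin_family_deriv_eq(_of_zero)` — so if the FORCED profile equation `E_(α_t)(U_t) + ∇P_t = Σ_j B_t j D_t j`
   holds for `t` near `0` at `y`, then `𝓛_(α₀,U₀) V(y) + G(y) + a 𝓡₀U₀(y) = Σ_j B'_j D₀ j(y) + Σ_j B₀ j D'_j(y)`; at a
   ZERO of the multipliers the last sum drops out and only continuity of the modes in `t` is needed.
3. `pairing_identity` — for a linear `ℓ` annihilating the differentiated range elements, with `J i j := ∂_i B_j(p⋆)`,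
   `z_j := ℓ(D_{p⋆ j})`, `a_i := ∂_i α(p⋆)`:  **`Σ_j J i j · z_j = a_i · ℓ(𝓡₀U⋆)`**; constant rate and `J` injective
   give `z = 0` (`pairing_eq_zero_of_rigidRate`).
4. `GateSpec.false_of_rigidRate` — with an exact cokernel functional `ℓ` of `𝓛_(α_{p⋆},U⁰_{p⋆}) + ∇` on the gate's
   output class detecting one unit forcing, X-bounded `V_i` with bounded `C¹` pressures solving
   `𝓛 V_i + ∇Q_i = Σ_j J i j D_{p⋆ j}`, `J` injective, a gate at `p⋆` is contradictory (`abs_le_of_cokernel_pairing`,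
   the `ε = 0` cokernel bound, restated from `GateSpec.abs_le_of_approxCokernel'`).
5. `GateSpec.one_le_rateGradient` — variable rate: if `J⁻¹` is bounded by `M` (ℓ¹ form) then
   `1 ≤ N · (M · |ℓ(𝓡₀U⋆)| · Σ_i |a_i|) · C₂ Γ^κ`; the pairing `η_rot` of the obstruction ledger is not a free property
   of the profile but `≤ M |ℓ(𝓡₀U⋆)| |∇_p α(p⋆)|` — the selection box must SCAN THE RATE.  The cube / interior-zero /
   closed-family forms and the informal reading are in `FilamentSkeletonRssKelvinGateRateLockingCube`.
-/

set_option linter.dupNamespace false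

noncomputable section

namespace Summit.NavierStokesRegularity.NavierStokesRegularity.Theorems.KelvinGate

open Set Function Filter
open Literature.Analysis.FluidPDE
open scoped InnerProductSpace Laplacian ContDiff Topology BigOperators

/-! ## 1. Differentiating the profile operator along a one-parameter family -/

/-- **Derivative of `t ↦ E_(α_t)(U_t)(y)` along a family.**  If at `t = 0` the rate `α_t`, the value `U_t(y)`, the
derivative `DU_t(y)` (in operator norm) and the Laplacian `ΔU_t(y)` are differentiable in `t` with derivatives `a`,
`V y`, `fderiv ℝ V y`, `(Δ V) y`, then the profile operator `lerayOp (α t) (U t) y` is differentiable in `t` with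
derivative `lerayLin (α 0) (U 0) V y + a • 𝓡₀(U 0)(y)`, `𝓡₀U(y) = e₃ × U(y) − DU(y)[e₃ × y]`.  Pure product rule. -/
theorem hasDerivAt_lerayOp_family {α : ℝ → ℝ} {a : ℝ}
    {U : ℝ → EuclideanSpace ℝ (Fin 3) → EuclideanSpace ℝ (Fin 3)} {V : EuclideanSpace ℝ (Fin 3) → EuclideanSpace ℝ (Fin 3)}
    (y : EuclideanSpace ℝ (Fin 3)) (hα : HasDerivAt α a 0)
    (hU : HasDerivAt (fun t => U t y) (V y) 0)
    (hDU : HasDerivAt (fun t => fderiv ℝ (U t) y) (fderiv ℝ V y) 0)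
    (hΔ : HasDerivAt (fun t => (Δ (U t)) y) ((Δ V) y) 0) :
    HasDerivAt (fun t => lerayOp (α t) (U t) y)
      (lerayLin (α 0) (U 0) V y +
        a • (cross (EuclideanSpace.single 2 1) (U 0 y) - fderiv ℝ (U 0) y (cross (EuclideanSpace.single 2 1) y))) 0 := by
  -- the rotation part `g t = e₃ × U_t(y) − DU_t(y)[e₃ × y]`
  have hcross : HasDerivAt (fun t => cross (EuclideanSpace.single 2 1) (U t y))
      (cross (EuclideanSpace.single 2 1) (V y)) 0 := by
    have := (rotGenL.hasFDerivAt).comp_hasDerivAt (0:ℝ) hU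
    simpa [Function.comp_def, cross_single_two_eq_rotGenL] using this
  have hrot : HasDerivAt (fun t => cross (EuclideanSpace.single 2 1) (U t y) -
      fderiv ℝ (U t) y (cross (EuclideanSpace.single 2 1) y))
      (cross (EuclideanSpace.single 2 1) (V y) - fderiv ℝ V y (cross (EuclideanSpace.single 2 1) y)) 0 := by
    have h2 := hDU.clm_apply (hasDerivAt_const (0:ℝ) (cross (EuclideanSpace.single 2 1) y))
    simp only [add_zero, map_zero] at h2
    exact hcross.sub h2
  have h1 : HasDerivAt (fun t => α t • (cross (EuclideanSpace.single 2 1) (U t y) -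
      fderiv ℝ (U t) y (cross (EuclideanSpace.single 2 1) y)))
      (α 0 • (cross (EuclideanSpace.single 2 1) (V y) - fderiv ℝ V y (cross (EuclideanSpace.single 2 1) y)) +
        a • (cross (EuclideanSpace.single 2 1) (U 0 y) - fderiv ℝ (U 0) y (cross (EuclideanSpace.single 2 1) y))) 0 :=
    hα.smul hrot
  have h3 : HasDerivAt (fun t => fderiv ℝ (U t) y y) (fderiv ℝ V y y) 0 := by
    have := hDU.clm_apply (hasDerivAt_const (0:ℝ) y)
    simpa using this
  have h5 : HasDerivAt (fun t => fderiv ℝ (U t) y (U t y)) (fderiv ℝ V y (U 0 y) + fderiv ℝ (U 0) y (V y)) 0 :=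
    hDU.clm_apply hU
  have hall := (((h1.add (hU.const_smul (1/2:ℝ))).add (h3.const_smul (1/2:ℝ))).sub hΔ).add h5
  have e : (fun t => lerayOp (α t) (U t) y) = fun t => α t • (cross (EuclideanSpace.single 2 1) (U t y) -
      fderiv ℝ (U t) y (cross (EuclideanSpace.single 2 1) y)) + (1/2:ℝ) • U t y + (1/2:ℝ) • fderiv ℝ (U t) y y -
      (Δ (U t)) y + fderiv ℝ (U t) y (U t y) := rfl
  rw [e]
  refine hall.congr_deriv ?_
  simp only [lerayLin]
  abel

/-- **The differentiated forced profile equation.**  Along a one-parameter family `(α_t, U_t, P_t, B_t, D_t)`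
satisfying `E_(α_t)(U_t)(y) + ∇P_t(y) = Σ_j B_t j • D_t j (y)` for `t` near `0` at the point `y`, with the
differentiability of `hasDerivAt_lerayOp_family` plus that of the pressure gradient (derivative `G y`), of the
multipliers (derivatives `B' j`) and of the modes (derivatives `D' j`):
`𝓛_(α₀,U₀) V(y) + G(y) + a • 𝓡₀U₀(y) = Σ_j B' j • D₀ j(y) + Σ_j B₀ j • D' j`. -/
theorem lerayLin_family_deriv_eq {N : ℕ} {α : ℝ → ℝ} {a : ℝ}
    {U : ℝ → EuclideanSpace ℝ (Fin 3) → EuclideanSpace ℝ (Fin 3)} {V G : EuclideanSpace ℝ (Fin 3) → EuclideanSpace ℝ (Fin 3)}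
    {P : ℝ → EuclideanSpace ℝ (Fin 3) → ℝ} {B : ℝ → Fin N → ℝ} {B' : Fin N → ℝ}
    {D : ℝ → Fin N → EuclideanSpace ℝ (Fin 3) → EuclideanSpace ℝ (Fin 3)} {D' : Fin N → EuclideanSpace ℝ (Fin 3)}
    (y : EuclideanSpace ℝ (Fin 3))
    (heq : ∀ᶠ t in 𝓝 (0:ℝ), lerayOp (α t) (U t) y + gradient (P t) y = ∑ j, B t j • D t j y)
    (hα : HasDerivAt α a 0)
    (hU : HasDerivAt (fun t => U t y) (V y) 0)
    (hDU : HasDerivAt (fun t => fderiv ℝ (U t) y) (fderiv ℝ V y) 0)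
    (hΔ : HasDerivAt (fun t => (Δ (U t)) y) ((Δ V) y) 0)
    (hP : HasDerivAt (fun t => gradient (P t) y) (G y) 0)
    (hB : ∀ j, HasDerivAt (fun t => B t j) (B' j) 0)
    (hD : ∀ j, HasDerivAt (fun t => D t j y) (D' j) 0) :
    lerayLin (α 0) (U 0) V y + G y +
        a • (cross (EuclideanSpace.single 2 1) (U 0 y) - fderiv ℝ (U 0) y (cross (EuclideanSpace.single 2 1) y)) =
      ∑ j, B' j • D 0 j y + ∑ j, B 0 j • D' j := by
  have hL := (hasDerivAt_lerayOp_family y hα hU hDU hΔ).add hP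
  have hR : HasDerivAt (fun t => ∑ j, B t j • D t j y) (∑ j, (B 0 j • D' j + B' j • D 0 j y)) 0 :=
    HasDerivAt.fun_sum fun j _ => (hB j).smul (hD j)
  have hR' : HasDerivAt (fun t => lerayOp (α t) (U t) y + gradient (P t) y)
      (∑ j, (B 0 j • D' j + B' j • D 0 j y)) 0 :=
    hR.congr_of_eventuallyEq heq
  have := hL.unique hR'
  rw [Finset.sum_add_distrib] at this
  rw [add_right_comm, this, add_comm]

/-- **At a zero of the multipliers the modes' own `p`-dependence drops out**: under the hypotheses of
`lerayLin_family_deriv_eq` with `B₀ = 0`, `𝓛_(α₀,U₀) V(y) + G(y) + a • 𝓡₀U₀(y) = Σ_j B' j • D₀ j(y)`; no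
differentiability of the modes in the parameter is needed. -/
theorem lerayLin_family_deriv_eq_of_zero {N : ℕ} {α : ℝ → ℝ} {a : ℝ}
    {U : ℝ → EuclideanSpace ℝ (Fin 3) → EuclideanSpace ℝ (Fin 3)} {V G : EuclideanSpace ℝ (Fin 3) → EuclideanSpace ℝ (Fin 3)}
    {P : ℝ → EuclideanSpace ℝ (Fin 3) → ℝ} {B : ℝ → Fin N → ℝ} {B' : Fin N → ℝ}
    {D : ℝ → Fin N → EuclideanSpace ℝ (Fin 3) → EuclideanSpace ℝ (Fin 3)}
    (y : EuclideanSpace ℝ (Fin 3))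
    (heq : ∀ᶠ t in 𝓝 (0:ℝ), lerayOp (α t) (U t) y + gradient (P t) y = ∑ j, B t j • D t j y)
    (hB0 : B 0 = 0)
    (hα : HasDerivAt α a 0)
    (hU : HasDerivAt (fun t => U t y) (V y) 0)
    (hDU : HasDerivAt (fun t => fderiv ℝ (U t) y) (fderiv ℝ V y) 0)
    (hΔ : HasDerivAt (fun t => (Δ (U t)) y) ((Δ V) y) 0)
    (hP : HasDerivAt (fun t => gradient (P t) y) (G y) 0)
    (hB : ∀ j, HasDerivAt (fun t => B t j) (B' j) 0)
    (hDc : ∀ j, ContinuousAt (fun t => D t j y) 0) :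
    lerayLin (α 0) (U 0) V y + G y +
        a • (cross (EuclideanSpace.single 2 1) (U 0 y) - fderiv ℝ (U 0) y (cross (EuclideanSpace.single 2 1) y)) =
      ∑ j, B' j • D 0 j y := by
  -- with `B 0 j = 0`, `t ↦ B t j • D t j y` has derivative `B' j • D 0 j y` as soon as `D · j y` is continuous
  have hL := (hasDerivAt_lerayOp_family y hα hU hDU hΔ).add hP
  have hR : HasDerivAt (fun t => ∑ j, B t j • D t j y) (∑ j, B' j • D 0 j y) 0 := by
    refine HasDerivAt.fun_sum fun j _ => ?_
    have hBj : HasDerivAt (fun t => B t j) (B' j) 0 := hB j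
    have hB0j : B 0 j = 0 := by rw [hB0]; rfl
    -- product of a function vanishing at 0 with derivative `B' j` and a continuous function
    rw [hasDerivAt_iff_isLittleO_nhds_zero] at hBj ⊢
    have hDc' : ContinuousAt (fun h : ℝ => D h j y) 0 := hDc j
    have key : (fun h : ℝ => (B h j - h * B' j) • D h j y + (h * B' j) • (D h j y - D 0 j y)) =o[𝓝 0]
        fun h => h := by
      refine Asymptotics.IsLittleO.add ?_ ?_
      · -- `(B h − h B') = o(h)` times a locally bounded factor
        have hB' : (fun h : ℝ => B h j - h * B' j) =o[𝓝 0] fun h => h := by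
          refine hBj.congr' (Eventually.of_forall fun h => ?_) EventuallyEq.rfl
          simp only [zero_add, hB0j, sub_zero, smul_eq_mul]
        have hbd : (fun h : ℝ => D h j y) =O[𝓝 0] (fun _ => (1:ℝ)) := hDc'.norm.isBoundedUnder_le.isBigO_one ℝ
        simpa using hB'.smul_isBigO hbd
      · -- `h B' = O(h)` times a factor tending to `0`
        have h1 : (fun h : ℝ => h * B' j) =O[𝓝 0] (fun h => h) := by
          simpa [mul_comm] using (Asymptotics.isBigO_refl (fun h : ℝ => h) (𝓝 0)).const_mul_left (B' j)
        have h2 : (fun h : ℝ => D h j y - D 0 j y) =o[𝓝 0] (fun _ => (1:ℝ)) := by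
          rw [Asymptotics.isLittleO_one_iff]
          have := hDc'.tendsto.sub (tendsto_const_nhds (x := D 0 j y))
          simpa using this
        simpa using h1.smul_isLittleO h2
    refine key.congr' (Eventually.of_forall fun h => ?_) EventuallyEq.rfl
    simp only [zero_add, hB0j, zero_smul, sub_zero]
    module
  have hR' : HasDerivAt (fun t => lerayOp (α t) (U t) y + gradient (P t) y) (∑ j, B' j • D 0 j y) 0 :=
    hR.congr_of_eventuallyEq heq
  have := hL.unique hR'
  rwa [add_right_comm] at this

/-! ## 2. Pairing with a cokernel functional: rate locking -/

/-- **Rate-locking identity.**  Let `ℓ` be a linear functional on vector fields (an exact cokernel functional of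
`𝓛 + ∇` restricted to the fields below — any linear functional on a subspace extends to all fields,
`LinearMap.exists_extend`), and suppose that along `N` parameter directions `i` the differentiated forced equation
`𝓛 V_i(y) + G_i(y) + a_i • R(y) = Σ_j J i j • D_j(y)` holds pointwise (`lerayLin_family_deriv_eq_of_zero`:
`J i j = ∂_i B_j`, `a_i = ∂_i α`, `R = 𝓡₀U⋆`) with `ℓ(𝓛 V_i + G_i) = 0`.  Then
`Σ_j J i j · ℓ(D_j) = a_i · ℓ(R)` for every `i`: the matrix of multiplier derivatives maps the pairing vector
`z = (ℓ(D_j))_j` to `ℓ(R) · ∇α`. -/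
theorem pairing_identity {N : ℕ} {ι : Type*} (ℓ : (EuclideanSpace ℝ (Fin 3) → EuclideanSpace ℝ (Fin 3)) →ₗ[ℝ] ℝ)
    {L G : ι → EuclideanSpace ℝ (Fin 3) → EuclideanSpace ℝ (Fin 3)} {R : EuclideanSpace ℝ (Fin 3) → EuclideanSpace ℝ (Fin 3)}
    {Dm : Fin N → EuclideanSpace ℝ (Fin 3) → EuclideanSpace ℝ (Fin 3)} {J : ι → Fin N → ℝ} {a : ι → ℝ}
    (hfam : ∀ i y, L i y + G i y + a i • R y = ∑ j, J i j • Dm j y)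
    (hker : ∀ i, ℓ (fun y => L i y + G i y) = 0) (i : ι) :
    ∑ j, J i j * ℓ (Dm j) = a i * ℓ R := by
  have hfun : (fun y => L i y + G i y) + a i • R =
      (∑ j, J i j • Dm j : EuclideanSpace ℝ (Fin 3) → EuclideanSpace ℝ (Fin 3)) := by
    funext y
    simp only [Pi.add_apply, Pi.smul_apply, Finset.sum_apply, hfam i y]
  have := congrArg ℓ hfun
  rw [map_add, map_smul, hker i, zero_add, map_sum] at this
  simp only [map_smul, smul_eq_mul] at this
  exact this.symm

/-- **Constant rate + transversal zero ⇒ every pairing vanishes.**  In `pairing_identity`, if the rate does not move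
along the `N` directions (`a = 0`) and the `N × N` matrix `J` is injective (a transversal zero of the multiplier map),
then `ℓ(D_j) = 0` for every accretion mode. -/
theorem pairing_eq_zero_of_rigidRate {N : ℕ} (ℓ : (EuclideanSpace ℝ (Fin 3) → EuclideanSpace ℝ (Fin 3)) →ₗ[ℝ] ℝ)
    {L G : Fin N → EuclideanSpace ℝ (Fin 3) → EuclideanSpace ℝ (Fin 3)}
    {Dm : Fin N → EuclideanSpace ℝ (Fin 3) → EuclideanSpace ℝ (Fin 3)} {J : Fin N → Fin N → ℝ}
    (hfam : ∀ i y, L i y + G i y = ∑ j, J i j • Dm j y)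
    (hker : ∀ i, ℓ (fun y => L i y + G i y) = 0)
    (hJ : ∀ z : Fin N → ℝ, (∀ i, ∑ j, J i j * z j = 0) → z = 0) (j : Fin N) :
    ℓ (Dm j) = 0 := by
  have hfam' : ∀ i y, L i y + G i y + (0:ℝ) • (0 : EuclideanSpace ℝ (Fin 3) → EuclideanSpace ℝ (Fin 3)) y =
      ∑ j, J i j • Dm j y := fun i y => by
    rw [zero_smul, add_zero]; exact hfam i y
  have hz := hJ (fun j => ℓ (Dm j)) fun i => by
    have := pairing_identity ℓ hfam' hker i
    rwa [zero_mul] at this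
  exact congrFun hz j

/-! ## 3. The cokernel bound from clause (1) of a gate at ONE parameter, and rate locking for a Kelvin gate -/

/-- **Cokernel bound from the gate's equation clause at one parameter.**  Suppose operators `(K, Qo, Bo)` invert the
linearised profile operator at the base `U` modulo the modes `Dm j` with constant `C` — clause (1) of `GateSpec` at a
single `p`, without the divergence clause: for `F` Y-bounded by `R`, `K F` is X-bounded by `C R`, `Qo F ∈ C¹` with
`|Qo F| ≤ C R`, `|Bo F j| ≤ C R`, and `𝓛_(a₀,U)(K F) + ∇(Qo F) = F + Σ_j (Bo F)_j Dm_j`.  If a linear functional `ℓ`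
vanishes on the range class (`XBound W S`, `Q ∈ C¹`, `|Q| ≤ S`) and pairs with every mode by at most `η`, then
`|ℓ F| ≤ N · η · (C R)` for every `F` Y-bounded by `R`.  (This is `GateSpec.abs_le_of_approxCokernel'` with `ε = 0`,
restated on exactly the data `GateSpec.perturb_core` delivers.) -/
theorem abs_le_of_cokernel_pairing {N : ℕ} {a₀ C η : ℝ} {U : EuclideanSpace ℝ (Fin 3) → EuclideanSpace ℝ (Fin 3)}
    {Dm : Fin N → EuclideanSpace ℝ (Fin 3) → EuclideanSpace ℝ (Fin 3)}
    {K : (EuclideanSpace ℝ (Fin 3) → EuclideanSpace ℝ (Fin 3)) → EuclideanSpace ℝ (Fin 3) → EuclideanSpace ℝ (Fin 3)}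
    {Qo : (EuclideanSpace ℝ (Fin 3) → EuclideanSpace ℝ (Fin 3)) → EuclideanSpace ℝ (Fin 3) → ℝ}
    {Bo : (EuclideanSpace ℝ (Fin 3) → EuclideanSpace ℝ (Fin 3)) → Fin N → ℝ}
    (hK : ∀ (F : EuclideanSpace ℝ (Fin 3) → EuclideanSpace ℝ (Fin 3)) (R : ℝ), YBound F R →
      XBound (K F) (C * R) ∧ ContDiff ℝ 1 (Qo F) ∧ (∀ y, |Qo F y| ≤ C * R) ∧ (∀ j, |Bo F j| ≤ C * R) ∧
      ∀ y, lerayLin a₀ U (K F) y + gradient (Qo F) y = F y + ∑ j, Bo F j • Dm j y)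
    (ℓ : (EuclideanSpace ℝ (Fin 3) → EuclideanSpace ℝ (Fin 3)) →ₗ[ℝ] ℝ)
    (hrange : ∀ (W : EuclideanSpace ℝ (Fin 3) → EuclideanSpace ℝ (Fin 3)) (Q : EuclideanSpace ℝ (Fin 3) → ℝ) (S : ℝ),
      XBound W S → ContDiff ℝ 1 Q → (∀ y, |Q y| ≤ S) → ℓ (fun y => lerayLin a₀ U W y + gradient Q y) = 0)
    (hη : ∀ j, |ℓ (Dm j)| ≤ η)
    (F : EuclideanSpace ℝ (Fin 3) → EuclideanSpace ℝ (Fin 3)) (R : ℝ) (hF : YBound F R) :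
    |ℓ F| ≤ N * η * (C * R) := by
  obtain ⟨hX, hQ1, hQ, hB, heq⟩ := hK F R hF
  have hfun : (fun y => lerayLin a₀ U (K F) y + gradient (Qo F) y) =
      F + (∑ j, Bo F j • Dm j : EuclideanSpace ℝ (Fin 3) → EuclideanSpace ℝ (Fin 3)) := by
    funext y; simp only [heq y, Pi.add_apply, Finset.sum_apply, Pi.smul_apply]
  have key := hrange (K F) (Qo F) (C * R) hX hQ1 hQ
  rw [hfun, map_add, map_sum] at key
  simp only [map_smul, smul_eq_mul] at key
  -- `ℓ F = − Σ_j b_j ℓ(Dm j)`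
  have hF' : ℓ F = -∑ j, Bo F j * ℓ (Dm j) := by linarith
  have hCR : 0 ≤ C * R := le_trans (abs_nonneg _) (hQ 0)
  calc |ℓ F| = |∑ j, Bo F j * ℓ (Dm j)| := by rw [hF', abs_neg]
    _ ≤ ∑ j, |Bo F j * ℓ (Dm j)| := Finset.abs_sum_le_sum_abs _ _
    _ ≤ ∑ _j : Fin N, (C * R) * η := Finset.sum_le_sum fun j _ => by
        rw [abs_mul]; exact mul_le_mul (hB j) (hη j) (abs_nonneg _) hCR
    _ = N * η * (C * R) := by
        simp only [Finset.sum_const, Finset.card_univ, Fintype.card_fin, nsmul_eq_mul]; ring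

/-- **Rate locking, core form (clause-(1) data at one parameter).**  With `(K, Qo, Bo)` as in
`abs_le_of_cokernel_pairing` around the base `U`, an exact cokernel functional `ℓ` detecting a unit forcing
(`YBound F₀ 1`, `ℓ F₀ = 1`), and a differentiated family `𝓛 V_i + ∇Q_i + a_i • R = Σ_j J i j • Dm_j`
(`lerayLin_family_deriv_eq_of_zero`) with X-bounded `V_i`, bounded `C¹` pressures `Q_i` and `J⁻¹` bounded by `M`
(`J z = c ⇒ |z_j| ≤ M Σ_i |c_i|`): `1 ≤ N · (M · |ℓ R| · Σ_i |a_i|) · C`.  The gate constant is bounded BELOW by the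
inverse of the rate gradient `a = ∇α` at the zero. -/
theorem one_le_rateGradient_core {N : ℕ} {a₀ C : ℝ} {U : EuclideanSpace ℝ (Fin 3) → EuclideanSpace ℝ (Fin 3)}
    {Dm : Fin N → EuclideanSpace ℝ (Fin 3) → EuclideanSpace ℝ (Fin 3)}
    {K : (EuclideanSpace ℝ (Fin 3) → EuclideanSpace ℝ (Fin 3)) → EuclideanSpace ℝ (Fin 3) → EuclideanSpace ℝ (Fin 3)}
    {Qo : (EuclideanSpace ℝ (Fin 3) → EuclideanSpace ℝ (Fin 3)) → EuclideanSpace ℝ (Fin 3) → ℝ}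
    {Bo : (EuclideanSpace ℝ (Fin 3) → EuclideanSpace ℝ (Fin 3)) → Fin N → ℝ}
    (hK : ∀ (F : EuclideanSpace ℝ (Fin 3) → EuclideanSpace ℝ (Fin 3)) (R : ℝ), YBound F R →
      XBound (K F) (C * R) ∧ ContDiff ℝ 1 (Qo F) ∧ (∀ y, |Qo F y| ≤ C * R) ∧ (∀ j, |Bo F j| ≤ C * R) ∧
      ∀ y, lerayLin a₀ U (K F) y + gradient (Qo F) y = F y + ∑ j, Bo F j • Dm j y)
    (ℓ : (EuclideanSpace ℝ (Fin 3) → EuclideanSpace ℝ (Fin 3)) →ₗ[ℝ] ℝ)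
    (hrange : ∀ (W : EuclideanSpace ℝ (Fin 3) → EuclideanSpace ℝ (Fin 3)) (Q : EuclideanSpace ℝ (Fin 3) → ℝ) (S : ℝ),
      XBound W S → ContDiff ℝ 1 Q → (∀ y, |Q y| ≤ S) → ℓ (fun y => lerayLin a₀ U W y + gradient Q y) = 0)
    (F₀ : EuclideanSpace ℝ (Fin 3) → EuclideanSpace ℝ (Fin 3)) (hF₀ : YBound F₀ 1) (hdet : ℓ F₀ = 1)
    (R : EuclideanSpace ℝ (Fin 3) → EuclideanSpace ℝ (Fin 3))
    (V : Fin N → EuclideanSpace ℝ (Fin 3) → EuclideanSpace ℝ (Fin 3)) (Q : Fin N → EuclideanSpace ℝ (Fin 3) → ℝ)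
    (S : Fin N → ℝ) (J : Fin N → Fin N → ℝ) (a : Fin N → ℝ) (M : ℝ)
    (hV : ∀ i, XBound (V i) (S i)) (hQ : ∀ i, ContDiff ℝ 1 (Q i)) (hQS : ∀ i y, |Q i y| ≤ S i)
    (hfam : ∀ i y, lerayLin a₀ U (V i) y + gradient (Q i) y + a i • R y = ∑ j, J i j • Dm j y)
    (hJ : ∀ z c : Fin N → ℝ, (∀ i, ∑ j, J i j * z j = c i) → ∀ j, |z j| ≤ M * ∑ i, |c i|) :
    1 ≤ N * (M * |ℓ R| * ∑ i, |a i|) * C := by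
  -- the pairings: `J z = ℓ(R) a`, hence `|z_j| ≤ M |ℓ R| Σ_i |a_i|`
  have hz : ∀ i, ∑ j, J i j * ℓ (Dm j) = a i * ℓ R := fun i =>
    pairing_identity ℓ (L := fun i y => lerayLin a₀ U (V i) y) (G := fun i y => gradient (Q i) y)
      hfam (fun i => hrange (V i) (Q i) (S i) (hV i) (hQ i) (hQS i)) i
  have hmodes : ∀ j, |ℓ (Dm j)| ≤ M * |ℓ R| * ∑ i, |a i| := by
    intro j
    have := hJ (fun j => ℓ (Dm j)) (fun i => a i * ℓ R) hz j
    calc |ℓ (Dm j)| ≤ M * ∑ i, |a i * ℓ R| := this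
      _ = M * |ℓ R| * ∑ i, |a i| := by
        have hs : ∑ i, |a i * ℓ R| = (∑ i, |a i|) * |ℓ R| := by
          rw [Finset.sum_mul]; exact Finset.sum_congr rfl fun i _ => abs_mul _ _
        rw [hs]; ring
  have key := abs_le_of_cokernel_pairing hK ℓ hrange hmodes F₀ 1 hF₀
  rwa [hdet, abs_one, mul_one] at key

/-- **Rate locking, core rigid form: constant rate + transversal zero + exact cokernel ⇒ no inversion modulo modes.**
As `one_le_rateGradient_core` with `a = 0` and `J` merely injective: `False`. -/
theorem false_of_rigidRate_core {N : ℕ} {a₀ C : ℝ} {U : EuclideanSpace ℝ (Fin 3) → EuclideanSpace ℝ (Fin 3)}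
    {Dm : Fin N → EuclideanSpace ℝ (Fin 3) → EuclideanSpace ℝ (Fin 3)}
    {K : (EuclideanSpace ℝ (Fin 3) → EuclideanSpace ℝ (Fin 3)) → EuclideanSpace ℝ (Fin 3) → EuclideanSpace ℝ (Fin 3)}
    {Qo : (EuclideanSpace ℝ (Fin 3) → EuclideanSpace ℝ (Fin 3)) → EuclideanSpace ℝ (Fin 3) → ℝ}
    {Bo : (EuclideanSpace ℝ (Fin 3) → EuclideanSpace ℝ (Fin 3)) → Fin N → ℝ}
    (hK : ∀ (F : EuclideanSpace ℝ (Fin 3) → EuclideanSpace ℝ (Fin 3)) (R : ℝ), YBound F R →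
      XBound (K F) (C * R) ∧ ContDiff ℝ 1 (Qo F) ∧ (∀ y, |Qo F y| ≤ C * R) ∧ (∀ j, |Bo F j| ≤ C * R) ∧
      ∀ y, lerayLin a₀ U (K F) y + gradient (Qo F) y = F y + ∑ j, Bo F j • Dm j y)
    (ℓ : (EuclideanSpace ℝ (Fin 3) → EuclideanSpace ℝ (Fin 3)) →ₗ[ℝ] ℝ)
    (hrange : ∀ (W : EuclideanSpace ℝ (Fin 3) → EuclideanSpace ℝ (Fin 3)) (Q : EuclideanSpace ℝ (Fin 3) → ℝ) (S : ℝ),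
      XBound W S → ContDiff ℝ 1 Q → (∀ y, |Q y| ≤ S) → ℓ (fun y => lerayLin a₀ U W y + gradient Q y) = 0)
    (F₀ : EuclideanSpace ℝ (Fin 3) → EuclideanSpace ℝ (Fin 3)) (hF₀ : YBound F₀ 1) (hdet : ℓ F₀ = 1)
    (V : Fin N → EuclideanSpace ℝ (Fin 3) → EuclideanSpace ℝ (Fin 3)) (Q : Fin N → EuclideanSpace ℝ (Fin 3) → ℝ)
    (S : Fin N → ℝ) (J : Fin N → Fin N → ℝ)
    (hV : ∀ i, XBound (V i) (S i)) (hQ : ∀ i, ContDiff ℝ 1 (Q i)) (hQS : ∀ i y, |Q i y| ≤ S i)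
    (hfam : ∀ i y, lerayLin a₀ U (V i) y + gradient (Q i) y = ∑ j, J i j • Dm j y)
    (hJ : ∀ z : Fin N → ℝ, (∀ i, ∑ j, J i j * z j = 0) → z = 0) : False := by
  have hmodes : ∀ j, |ℓ (Dm j)| ≤ 0 := fun j => le_of_eq (by
    rw [pairing_eq_zero_of_rigidRate ℓ (L := fun i y => lerayLin a₀ U (V i) y) (G := fun i y => gradient (Q i) y)
      hfam (fun i => hrange (V i) (Q i) (S i) (hV i) (hQ i) (hQS i)) hJ j, abs_zero])
  have key := abs_le_of_cokernel_pairing hK ℓ hrange hmodes F₀ 1 hF₀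
  rw [hdet, abs_one] at key
  linarith

/-- Clause (1) of `GateSpec` at a cube point, in the unbundled form used by the core lemmas (divergence dropped). -/
theorem GateSpec.clause_one {N : ℕ} {Γ κ C₂ : ℝ} {α : (Fin N → ℝ) → ℝ}
    {D : (Fin N → ℝ) → Fin N → EuclideanSpace ℝ (Fin 3) → EuclideanSpace ℝ (Fin 3)}
    {U0 : (Fin N → ℝ) → EuclideanSpace ℝ (Fin 3) → EuclideanSpace ℝ (Fin 3)}
    {𝓚 : (Fin N → ℝ) → (EuclideanSpace ℝ (Fin 3) → EuclideanSpace ℝ (Fin 3)) → EuclideanSpace ℝ (Fin 3) → EuclideanSpace ℝ (Fin 3)}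
    {𝓠 : (Fin N → ℝ) → (EuclideanSpace ℝ (Fin 3) → EuclideanSpace ℝ (Fin 3)) → EuclideanSpace ℝ (Fin 3) → ℝ}
    {𝓑 : (Fin N → ℝ) → (EuclideanSpace ℝ (Fin 3) → EuclideanSpace ℝ (Fin 3)) → Fin N → ℝ}
    (h : GateSpec N Γ κ C₂ α D U0 𝓚 𝓠 𝓑) {p : Fin N → ℝ} (hp : ∀ i, p i ∈ Icc (0:ℝ) 1) :
    ∀ (F : EuclideanSpace ℝ (Fin 3) → EuclideanSpace ℝ (Fin 3)) (R : ℝ), YBound F R →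
      XBound (𝓚 p F) (C₂ * Γ ^ κ * R) ∧ ContDiff ℝ 1 (𝓠 p F) ∧ (∀ y, |𝓠 p F y| ≤ C₂ * Γ ^ κ * R) ∧
      (∀ j, |𝓑 p F j| ≤ C₂ * Γ ^ κ * R) ∧
      ∀ y, lerayLin (α p) (U0 p) (𝓚 p F) y + gradient (𝓠 p F) y = F y + ∑ j, 𝓑 p F j • D p j y := by
  intro F R hF
  obtain ⟨hX, hQ1, hQ, hB, -, heq⟩ := (h p hp).1 F R hF
  exact ⟨hX, hQ1, hQ, hB, heq⟩

/-- **No Kelvin gate at a transversal constant-rate zero carrying an exact cokernel functional.**  Let the gate spec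
hold with constants `(κ, C₂)` around the base family `U⁰`, and fix `p` in the cube.  Suppose `ℓ` is a linear
functional on vector fields which VANISHES on the range class of the gate,
`ℓ(𝓛_(α_p,U⁰_p) W + ∇Q) = 0` whenever `W` is X-bounded by `S` and `Q ∈ C¹` with `|Q| ≤ S` (an exact cokernel
functional), and which detects some unit forcing `F₀` (`YBound F₀ 1`, `ℓ F₀ = 1`).  Suppose finally that there are
X-bounded fields `V_i` with bounded `C¹` pressures `Q_i` (`i = 1 … N`) solving
`𝓛 V_i + ∇Q_i = Σ_j J i j • D_pj` pointwise with `J` injective — exactly what differentiating a `C¹`-in-`p` reduced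
family of CONSTANT rate at a transversal zero of its multipliers yields (`lerayLin_family_deriv_eq_of_zero`).  Then
`False`: the functional annihilates every mode (`pairing_eq_zero_of_rigidRate`), hence everything. -/
theorem GateSpec.false_of_rigidRate {N : ℕ} {Γ κ C₂ : ℝ} {α : (Fin N → ℝ) → ℝ}
    {D : (Fin N → ℝ) → Fin N → EuclideanSpace ℝ (Fin 3) → EuclideanSpace ℝ (Fin 3)}
    {U0 : (Fin N → ℝ) → EuclideanSpace ℝ (Fin 3) → EuclideanSpace ℝ (Fin 3)}
    {𝓚 : (Fin N → ℝ) → (EuclideanSpace ℝ (Fin 3) → EuclideanSpace ℝ (Fin 3)) → EuclideanSpace ℝ (Fin 3) → EuclideanSpace ℝ (Fin 3)}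
    {𝓠 : (Fin N → ℝ) → (EuclideanSpace ℝ (Fin 3) → EuclideanSpace ℝ (Fin 3)) → EuclideanSpace ℝ (Fin 3) → ℝ}
    {𝓑 : (Fin N → ℝ) → (EuclideanSpace ℝ (Fin 3) → EuclideanSpace ℝ (Fin 3)) → Fin N → ℝ}
    (h : GateSpec N Γ κ C₂ α D U0 𝓚 𝓠 𝓑) {p : Fin N → ℝ} (hp : ∀ i, p i ∈ Icc (0:ℝ) 1)
    (ℓ : (EuclideanSpace ℝ (Fin 3) → EuclideanSpace ℝ (Fin 3)) →ₗ[ℝ] ℝ)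
    (hrange : ∀ (W : EuclideanSpace ℝ (Fin 3) → EuclideanSpace ℝ (Fin 3)) (Q : EuclideanSpace ℝ (Fin 3) → ℝ) (S : ℝ),
      XBound W S → ContDiff ℝ 1 Q → (∀ y, |Q y| ≤ S) →
      ℓ (fun y => lerayLin (α p) (U0 p) W y + gradient Q y) = 0)
    (F₀ : EuclideanSpace ℝ (Fin 3) → EuclideanSpace ℝ (Fin 3)) (hF₀ : YBound F₀ 1) (hdet : ℓ F₀ = 1)
    (V : Fin N → EuclideanSpace ℝ (Fin 3) → EuclideanSpace ℝ (Fin 3)) (Q : Fin N → EuclideanSpace ℝ (Fin 3) → ℝ)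
    (S : Fin N → ℝ) (J : Fin N → Fin N → ℝ)
    (hV : ∀ i, XBound (V i) (S i)) (hQ : ∀ i, ContDiff ℝ 1 (Q i)) (hQS : ∀ i y, |Q i y| ≤ S i)
    (hfam : ∀ i y, lerayLin (α p) (U0 p) (V i) y + gradient (Q i) y = ∑ j, J i j • D p j y)
    (hJ : ∀ z : Fin N → ℝ, (∀ i, ∑ j, J i j * z j = 0) → z = 0) : False :=
  false_of_rigidRate_core (h.clause_one hp) ℓ hrange F₀ hF₀ hdet V Q S J hV hQ hQS hfam hJ

/-- **Quantitative rate locking for a Kelvin gate.**  Same setting as `GateSpec.false_of_rigidRate`, but now the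
differentiated family carries a rate term: `𝓛 V_i + ∇Q_i + a_i • R = Σ_j J i j • D_pj` pointwise (`a_i = ∂_i α(p)`,
`R = 𝓡₀U⁰_p` in the application), and `J` has an inverse bounded by `M` in the sense
`(∀ i, Σ_j J i j z_j = c_i) → |z_j| ≤ M Σ_i |c_i|`.  Then the gate constant obeys
`1 ≤ N · (M · |ℓ R| · Σ_i |a_i|) · (C₂ Γ^κ)`: the mode pairings are at most `M |ℓ R| |∇α|`, and the cokernel bound
does the rest.  With `a = 0` this reads `1 ≤ 0`. -/
theorem GateSpec.one_le_rateGradient {N : ℕ} {Γ κ C₂ : ℝ} {α : (Fin N → ℝ) → ℝ}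
    {D : (Fin N → ℝ) → Fin N → EuclideanSpace ℝ (Fin 3) → EuclideanSpace ℝ (Fin 3)}
    {U0 : (Fin N → ℝ) → EuclideanSpace ℝ (Fin 3) → EuclideanSpace ℝ (Fin 3)}
    {𝓚 : (Fin N → ℝ) → (EuclideanSpace ℝ (Fin 3) → EuclideanSpace ℝ (Fin 3)) → EuclideanSpace ℝ (Fin 3) → EuclideanSpace ℝ (Fin 3)}
    {𝓠 : (Fin N → ℝ) → (EuclideanSpace ℝ (Fin 3) → EuclideanSpace ℝ (Fin 3)) → EuclideanSpace ℝ (Fin 3) → ℝ}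
    {𝓑 : (Fin N → ℝ) → (EuclideanSpace ℝ (Fin 3) → EuclideanSpace ℝ (Fin 3)) → Fin N → ℝ}
    (h : GateSpec N Γ κ C₂ α D U0 𝓚 𝓠 𝓑) {p : Fin N → ℝ} (hp : ∀ i, p i ∈ Icc (0:ℝ) 1)
    (ℓ : (EuclideanSpace ℝ (Fin 3) → EuclideanSpace ℝ (Fin 3)) →ₗ[ℝ] ℝ)
    (hrange : ∀ (W : EuclideanSpace ℝ (Fin 3) → EuclideanSpace ℝ (Fin 3)) (Q : EuclideanSpace ℝ (Fin 3) → ℝ) (S : ℝ),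
      XBound W S → ContDiff ℝ 1 Q → (∀ y, |Q y| ≤ S) →
      ℓ (fun y => lerayLin (α p) (U0 p) W y + gradient Q y) = 0)
    (F₀ : EuclideanSpace ℝ (Fin 3) → EuclideanSpace ℝ (Fin 3)) (hF₀ : YBound F₀ 1) (hdet : ℓ F₀ = 1)
    (R : EuclideanSpace ℝ (Fin 3) → EuclideanSpace ℝ (Fin 3))
    (V : Fin N → EuclideanSpace ℝ (Fin 3) → EuclideanSpace ℝ (Fin 3)) (Q : Fin N → EuclideanSpace ℝ (Fin 3) → ℝ)
    (S : Fin N → ℝ) (J : Fin N → Fin N → ℝ) (a : Fin N → ℝ) (M : ℝ)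
    (hV : ∀ i, XBound (V i) (S i)) (hQ : ∀ i, ContDiff ℝ 1 (Q i)) (hQS : ∀ i y, |Q i y| ≤ S i)
    (hfam : ∀ i y, lerayLin (α p) (U0 p) (V i) y + gradient (Q i) y + a i • R y = ∑ j, J i j • D p j y)
    (hJ : ∀ z c : Fin N → ℝ, (∀ i, ∑ j, J i j * z j = c i) → ∀ j, |z j| ≤ M * ∑ i, |c i|) :
    1 ≤ N * (M * |ℓ R| * ∑ i, |a i|) * (C₂ * Γ ^ κ) :=
  one_le_rateGradient_core (h.clause_one hp) ℓ hrange F₀ hF₀ hdet R V Q S J a M hV hQ hQS hfam hJ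

end Summit.NavierStokesRegularity.NavierStokesRegularity.Theorems.KelvinGate
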